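import Literature.MathematicalPhysics.QuantumFieldTheory.SpeciesLatticeProducts
import Literature.MathematicalPhysics.QuantumLattice.MeshUniformLatticeSums
import HarnessLib

/-!
# Mesh-uniform sup bounds of smeared lattice fields of Yang–Mills species

Sequel of `SpeciesLatticeProducts` (G-blind bookkeeping for the lattice side of `IsYangMillsFor`):
sup-norm bounds of the lattice representatives `obsProd`, `SlabSum.rep` of slab-ordered product
tensors that are UNIFORM in the box and POLYNOMIAL in the inverse lattice spacing — the input of
transfer-matrix arguments on a torus that carry a thermal (finite time extent) slack proportional
to the squared sup norm of the observable. Nothing about mass gaps is asserted; all statements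
here are proved. Content:

* `exists_prod_weight_mul_abs_le` — product-form Schwartz decay `∏ᵢ (1+|yᵢ|)² |f(y)| ≤ M`;
  `pow_mul_abs_apply_le_prod_weight`, `pow_mul_sum_box_abs_le`, `exists_latticeSum_le` — the
  Riemann sums `a^d Σ_{x ∈ box d L} |f(a x)|` of a Schwartz function are bounded uniformly in the
  box and in the mesh `0 < a ≤ 1` (product trick and the telescoping one-dimensional bound of
  `MeshUniformLatticeSums`; Glimm–Jaffe 1987 §9.5–9.6);
* `abs_smearedLatticeField_le`, `abs_obsProd_le` — `|Φ_a(f)| ≤ |c| · a⁴Σ|f(a·)| · (‖O‖_∞ + |m|)` and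
  its product form;
* `SlabSum.exists_norm_rep_le_pow` — if `|c_{σⱼ}(k)|, |m_{σⱼ}(k)| ≤ K_j a_k^{-q_j}` (polynomially
  bounded renormalisations of the species of the string) then `‖rep D S σ k‖_∞ ≤ K a_k^{-q}`
  whenever `a_k ≤ 1`.

References: J. Glimm, A. Jaffe, Quantum Physics (1987) §9.5–9.6 (lattice approximation, Riemann
sums of test functions); K. Osterwalder, E. Seiler, Ann. Phys. 110 (1978) 440, §2.
-/

open scoped SchwartzMap
open Literature.Probability.LatticeModels (box mem_box)
open Literature.MathematicalPhysics.AQFT Literature.MathematicalPhysics.QuantumLattice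

noncomputable section

namespace Literature.MathematicalPhysics.QuantumFieldTheory

/-! ### Schwartz functions summed over lattice boxes -/

section Schwartz

variable {d : ℕ}

/-- **Product-form decay of a Schwartz function on `ℝᵈ`**: `∏ᵢ (1+|yᵢ|)² |f(y)| ≤ M` (from
`(1+‖y‖)^{2d} |f(y)| ≤ M` and `|yᵢ| ≤ ‖y‖`). [folklore] -/
theorem exists_prod_weight_mul_abs_le (f : 𝓢(EuclideanSpace ℝ (Fin d), ℝ)) :
    ∃ M : ℝ, 0 ≤ M ∧ ∀ y : EuclideanSpace ℝ (Fin d), (∏ i, (1 + |y i|) ^ 2) * |f y| ≤ M := by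
  -- adapted from `QuantumLattice/LatticeScalarFieldTailProofs` (`schwartz_prod_decay`)
  obtain ⟨M, hM⟩ : ∃ M : ℝ, ∀ y : EuclideanSpace ℝ (Fin d), (1 + ‖y‖) ^ (2 * d) * |f y| ≤ M := by
    refine ⟨2 ^ (2 * d) *
      (Finset.Iic (2 * d, 0)).sup (fun m => SchwartzMap.seminorm ℝ m.1 m.2) f, fun y => ?_⟩
    have h := SchwartzMap.one_add_le_sup_seminorm_apply (𝕜 := ℝ) (m := (2 * d, 0))
      (k := 2 * d) (n := 0) le_rfl le_rfl f y
    rwa [norm_iteratedFDeriv_zero, Real.norm_eq_abs] at h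
  refine ⟨M, le_trans (by positivity) (hM 0), fun y => le_trans ?_ (hM y)⟩
  refine mul_le_mul_of_nonneg_right ?_ (abs_nonneg _)
  calc ∏ i, (1 + |y i|) ^ 2 ≤ ∏ _i : Fin d, (1 + ‖y‖) ^ 2 := by
        refine Finset.prod_le_prod (fun i _ => by positivity) fun i _ => ?_
        have hyi : |y i| ≤ ‖y‖ := by simpa using PiLp.norm_apply_le y i
        exact pow_le_pow_left₀ (by positivity) (by linarith) 2
    _ = (1 + ‖y‖) ^ (2 * d) := by rw [Finset.prod_const, Finset.card_univ, Fintype.card_fin, ← pow_mul]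

/-- The pointwise bound `a^d |f(a x)| ≤ M ∏ᵢ a/(1 + a|xᵢ|)²` at a lattice site `x`. [folklore] -/
theorem pow_mul_abs_apply_le_prod_weight {f : 𝓢(EuclideanSpace ℝ (Fin d), ℝ)} {M : ℝ}
    (hM : ∀ y : EuclideanSpace ℝ (Fin d), (∏ i, (1 + |y i|) ^ 2) * |f y| ≤ M) {a : ℝ} (ha : 0 < a)
    (x : Literature.Probability.LatticeModels.Site d) : a ^ d * |f (a • siteToE x)| ≤ M * ∏ i, a / (1 + a * |(x i : ℝ)|) ^ 2 := by
  -- adapted from `QuantumLattice/LatticeScalarFieldTailProofs` (`pow_mul_abs_le_wtd`)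
  set P : ℝ := ∏ i, (1 + a * |(x i : ℝ)|) ^ 2 with hP
  have hP0 : 0 < P := by positivity
  have hwtd : ∏ i, a / (1 + a * |(x i : ℝ)|) ^ 2 = a ^ d / P := by
    rw [hP, Finset.prod_div_distrib, Finset.prod_const, Finset.card_univ, Fintype.card_fin]
  have hfy : P * |f (a • siteToE x)| ≤ M := by
    have h := hM (a • siteToE x)
    have hcoord : ∀ i, |(a • siteToE x) i| = a * |(x i : ℝ)| := fun i => by
      rw [PiLp.smul_apply, siteToE_apply, smul_eq_mul, abs_mul, abs_of_pos ha]
    simp only [hcoord] at h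
    exact h
  have hf_le : |f (a • siteToE x)| ≤ M / P := by
    rw [le_div_iff₀ hP0, mul_comm]
    exact hfy
  calc a ^ d * |f (a • siteToE x)| ≤ a ^ d * (M / P) :=
        mul_le_mul_of_nonneg_left hf_le (by positivity)
    _ = M * (a ^ d / P) := by ring
    _ = M * ∏ i, a / (1 + a * |(x i : ℝ)|) ^ 2 := by rw [hwtd]

/-- **Mesh-uniform Riemann bound**: `a^d Σ_{x ∈ box d L} |f(a x)| ≤ M (2(a+1))^d`, uniformly in
the box (`M` the product-form decay constant of `f`). [cite: GlimmJaffe1987, §9.5–9.6] -/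
theorem pow_mul_sum_box_abs_le {f : 𝓢(EuclideanSpace ℝ (Fin d), ℝ)} {M : ℝ}
    (hM : ∀ y : EuclideanSpace ℝ (Fin d), (∏ i, (1 + |y i|) ^ 2) * |f y| ≤ M) {a : ℝ} (ha : 0 < a)
    (L : ℕ) : a ^ d * ∑ x ∈ box d L, |f (a • siteToE x)| ≤ M * (2 * (a + 1)) ^ d := by
  have hM0 : 0 ≤ M := le_trans (by positivity) (hM 0)
  calc a ^ d * ∑ x ∈ box d L, |f (a • siteToE x)|
      = ∑ x ∈ box d L, a ^ d * |f (a • siteToE x)| := Finset.mul_sum _ _ _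
    _ ≤ ∑ x ∈ box d L, M * ∏ i, a / (1 + a * |(x i : ℝ)|) ^ 2 :=
        Finset.sum_le_sum fun x _ => pow_mul_abs_apply_le_prod_weight hM ha x
    _ = M * ∑ x ∈ box d L, ∏ i, a / (1 + a * |(x i : ℝ)|) ^ 2 := (Finset.mul_sum _ _ _).symm
    _ ≤ M * (2 * (a + 1)) ^ d := by
        refine mul_le_mul_of_nonneg_left ?_ hM0
        have h := sum_piFinset_prod_weight_le (ι := Fin d) a ha.le (Finset.Icc (-(L : ℤ)) L)
        rw [Fintype.card_fin] at h
        simpa [box] using h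

/-- **Uniform lattice-sum bound of a Schwartz function**: there is `C ≥ 0` with
`a^d Σ_{x ∈ box d L} |f(a x)| ≤ C` for all meshes `0 < a ≤ 1` and all boxes. [cite: GlimmJaffe1987, §9.5–9.6] -/
theorem exists_latticeSum_le (f : 𝓢(EuclideanSpace ℝ (Fin d), ℝ)) :
    ∃ C : ℝ, 0 ≤ C ∧ ∀ a : ℝ, 0 < a → a ≤ 1 → ∀ L : ℕ,
      a ^ d * ∑ x ∈ box d L, |f (a • siteToE x)| ≤ C := by
  obtain ⟨M, hM0, hM⟩ := exists_prod_weight_mul_abs_le f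
  refine ⟨M * 4 ^ d, by positivity, fun a ha ha1 L => (pow_mul_sum_box_abs_le hM ha L).trans ?_⟩
  exact mul_le_mul_of_nonneg_left (pow_le_pow_left₀ (by positivity) (by linarith) d) hM0

end Schwartz

/-! ### Sup bounds of smeared lattice fields and of representatives -/

section Species

variable {G : Type} [Group G] [MeasurableSpace G]

omit [Group G] in
/-- `|Φ_a(f)(V)| ≤ |c| · (a⁴ Σ_{x ∈ Λ} |f(a x)|) · (C_O + |m|)` when `|O| ≤ C_O`. [folklore] -/
theorem abs_smearedLatticeField_le {O : LGConfig 4 G → ℝ} {CO : ℝ} (hO : ∀ U, |O U| ≤ CO)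
    (Λ : Finset (Literature.Probability.LatticeModels.Site 4)) (a c m : ℝ) (f : 𝓢(EuclideanSpace ℝ (Fin 4), ℝ)) (V : LGConfig 4 G) :
    |smearedLatticeField O Λ a c m f V| ≤
      |c| * (a ^ 4 * ∑ x ∈ Λ, |f (a • siteToE x)|) * (CO + |m|) := by
  -- adapted from `SpeciesLatticeProducts` (`exists_bound_smearedLatticeField`)
  have hS : |∑ x ∈ Λ, f (a • siteToE x) * (O (configShift (-x) V) - m)| ≤
      (∑ x ∈ Λ, |f (a • siteToE x)|) * (CO + |m|) := by
    rw [Finset.sum_mul]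
    refine (Finset.abs_sum_le_sum_abs _ _).trans (Finset.sum_le_sum fun x _ => ?_)
    rw [abs_mul]
    exact mul_le_mul_of_nonneg_left ((abs_sub _ _).trans (add_le_add (hO _) le_rfl)) (abs_nonneg _)
  unfold smearedLatticeField
  rw [abs_mul, abs_mul, abs_of_nonneg (by positivity : (0 : ℝ) ≤ a ^ 4)]
  refine (mul_le_mul_of_nonneg_left hS (by positivity)).trans_eq ?_
  ring

/-- **Sup bound of a product observable**: if `|O_{σⱼ}| ≤ C_j` and
`a_k⁴ Σ_{x ∈ box} |fⱼ(a_k x)| ≤ Cf_j` for all `j`, then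
`|obsProd S k σ f U| ≤ ∏ⱼ |c_{σⱼ}(k)| · Cf_j · (C_j + |m_{σⱼ}(k)|)`. [folklore] -/
theorem abs_obsProd_le (S : SpeciesScheme (YMSpecies G)) (k : ℕ) {n : ℕ} (σ : Fin n → YMSpecies G)
    (f : Fin n → 𝓢(EuclideanSpace ℝ (Fin 4), ℝ)) {Cσ Cf : Fin n → ℝ}
    (hCσ : ∀ j U, |(σ j).F U| ≤ Cσ j)
    (hCf : ∀ j, S.a k ^ 4 * ∑ x ∈ box 4 (S.L k), |f j (S.a k • siteToE x)| ≤ Cf j)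
    (U : GaugeConfig 4 (S.side k) G) :
    |obsProd S k σ f U| ≤ ∏ j, |S.c (σ j) k| * Cf j * (Cσ j + |S.m (σ j) k|) := by
  rw [obsProd, Finset.abs_prod]
  refine Finset.prod_le_prod (fun j _ => abs_nonneg _) fun j _ => ?_
  refine (abs_smearedLatticeField_le (hCσ j) _ _ _ _ (f j) _).trans ?_
  have hC0 : 0 ≤ Cσ j := (abs_nonneg _).trans (hCσ j (torusLift (S.side k) U))
  have h1 : 0 ≤ Cσ j + |S.m (σ j) k| := by positivity
  exact mul_le_mul_of_nonneg_right (mul_le_mul_of_nonneg_left (hCf j) (abs_nonneg _)) h1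

/-- **Polynomial sup bound of representatives.** If the renormalisations of the species of the
string `σ` are polynomially bounded in the inverse spacing — `|c_{σⱼ}(k)|, |m_{σⱼ}(k)| ≤ K_j a_k^{-q_j}`
for all `k` — then for every slab sum `D` there are `q, K ≥ 0` with `‖rep D S σ k U‖ ≤ K a_k^{-q}`
for all `U` whenever `a_k ≤ 1` (mesh-uniform Riemann bounds of the factors and `|O_{σⱼ}| ≤ C_j`).
[folklore] -/
theorem SlabSum.exists_norm_rep_le_pow {n : ℕ} (D : SlabSum n) (S : SpeciesScheme (YMSpecies G))
    (σ : Fin n → YMSpecies G)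
    (hS : ∀ j, ∃ (q : ℕ) (K : ℝ), ∀ k,
      |S.c (σ j) k| ≤ K * ((S.a k)⁻¹) ^ q ∧ |S.m (σ j) k| ≤ K * ((S.a k)⁻¹) ^ q) :
    ∃ (q : ℕ) (K : ℝ), 0 ≤ K ∧
      ∀ k, S.a k ≤ 1 → ∀ U, ‖D.rep S σ k U‖ ≤ K * ((S.a k)⁻¹) ^ q := by
  choose qσ Kσ hσ using hS
  choose Cσ hCσ using fun j => (σ j).bounded
  choose Cf hCf0 hCf using fun i j => exists_latticeSum_le (d := 4) (D.f i j)
  have hK0 : ∀ j, 0 ≤ Kσ j := fun j => by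
    have h := (hσ j 0).1
    have hA : 0 < ((S.a 0)⁻¹) ^ qσ j := pow_pos (inv_pos.2 (S.a_pos 0)) _
    by_contra hneg
    push Not at hneg
    have : Kσ j * ((S.a 0)⁻¹) ^ qσ j < 0 := mul_neg_of_neg_of_pos hneg hA
    linarith [abs_nonneg (S.c (σ j) 0)]
  have hC0 : ∀ j, 0 ≤ Cσ j := fun j => (abs_nonneg _).trans (hCσ j 1)
  refine ⟨∑ j, (qσ j + qσ j), ∑ i, ‖D.c i‖ * ∏ j, Kσ j * Cf i j * (Cσ j + Kσ j),
    Finset.sum_nonneg fun i _ => mul_nonneg (norm_nonneg _) (Finset.prod_nonneg fun j _ => ?_),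
    fun k hk U => ?_⟩
  · have := hK0 j; have := hC0 j; have := hCf0 i j
    positivity
  have ha := S.a_pos k
  have hA1 : 1 ≤ (S.a k)⁻¹ := (one_le_inv₀ ha).2 hk
  have hfac : ∀ i j, |S.c (σ j) k| * Cf i j * (Cσ j + |S.m (σ j) k|) ≤
      Kσ j * Cf i j * (Cσ j + Kσ j) * (S.a k)⁻¹ ^ (qσ j + qσ j) := by
    intro i j
    have h1 := (hσ j k).1
    have h2 := (hσ j k).2
    have hAq : 1 ≤ (S.a k)⁻¹ ^ qσ j := one_le_pow₀ hA1
    have hK := hK0 j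
    have hC := hC0 j
    have hCf' := hCf0 i j
    have e1 : |S.c (σ j) k| * Cf i j ≤ Kσ j * (S.a k)⁻¹ ^ qσ j * Cf i j :=
      mul_le_mul_of_nonneg_right h1 hCf'
    have e2 : Cσ j + |S.m (σ j) k| ≤ Cσ j * (S.a k)⁻¹ ^ qσ j + Kσ j * (S.a k)⁻¹ ^ qσ j :=
      add_le_add (le_mul_of_one_le_right hC hAq) h2
    calc |S.c (σ j) k| * Cf i j * (Cσ j + |S.m (σ j) k|)
        ≤ Kσ j * (S.a k)⁻¹ ^ qσ j * Cf i j * (Cσ j * (S.a k)⁻¹ ^ qσ j + Kσ j * (S.a k)⁻¹ ^ qσ j) :=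
          mul_le_mul e1 e2 (by positivity) (by positivity)
      _ = Kσ j * Cf i j * (Cσ j + Kσ j) * (S.a k)⁻¹ ^ (qσ j + qσ j) := by ring
  unfold SlabSum.rep
  calc ‖∑ i, D.c i * ((obsProd S k σ (D.f i) U : ℝ) : ℂ)‖
      ≤ ∑ i, ‖D.c i‖ * |obsProd S k σ (D.f i) U| := by
        refine (norm_sum_le _ _).trans (le_of_eq (Finset.sum_congr rfl fun i _ => ?_))
        rw [norm_mul, Complex.norm_real, Real.norm_eq_abs]
    _ ≤ ∑ i, ‖D.c i‖ * ∏ j, Kσ j * Cf i j * (Cσ j + Kσ j) * (S.a k)⁻¹ ^ (qσ j + qσ j) := by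
        refine Finset.sum_le_sum fun i _ => mul_le_mul_of_nonneg_left ?_ (norm_nonneg _)
        refine (abs_obsProd_le S k σ (D.f i) hCσ (fun j => hCf i j _ ha hk _) U).trans ?_
        exact Finset.prod_le_prod (fun j _ => by have := hC0 j; have := hCf0 i j; positivity)
          fun j _ => hfac i j
    _ = (∑ i, ‖D.c i‖ * ∏ j, Kσ j * Cf i j * (Cσ j + Kσ j)) * (S.a k)⁻¹ ^ ∑ j, (qσ j + qσ j) := by
        rw [Finset.sum_mul]
        refine Finset.sum_congr rfl fun i _ => ?_
        rw [Finset.prod_mul_distrib, Finset.prod_pow_eq_pow_sum, mul_assoc]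

end Species

end Literature.MathematicalPhysics.QuantumFieldTheory

end
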